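/-
Copyright: cell pub-balaban-gaps, seat ne8 (estimate NE7c), gen 13. Project licence.
-/
import Summits.QuantumFields.BalabanUV.T4Continuum.Spine.NE7b.CompactFibreWindowSU2Rate
import Summits.QuantumFields.BalabanUV.T4Continuum.Spine.NE7b.CompactFibreProfileVolumeSU2
import Summits.QuantumFields.BalabanUV.T4Continuum.Spine.NE7c.LiveFactorWindowVolume

/-!
# Road (δ) on the (n)-carrier's window-volume letter AT PRINT'S RATE `½d(𝔤)` (ne6's V26) and on its PROFILE letter (V27): at a live
# window `W_{νη}` the RATE `(3∕2)·log η⁻¹` per bond is ASSIGNMENT-FREE on BOTH sides — the live factor sits in print's CONSTANT `log σ₀`,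
# moved by at most `(3∕2)·log ν₀⁻¹` per bond —, the profile letter is FREE below one nesting clause, and the creation-step price with the
# sharp letter has ONE value for the grid (row NE7c; junction J-13)

Cell `pub-balaban-gaps` (G2), seat ne8, estimate **NE7c** (`T4IndicatorShell.ShellWeightBound`; two-run artefact, NOT PRINTED in
[Bałaban 1983–89], NOT PROVED).  Twenty-seventh proof-only file under `Spine/NE7c/`: seat ne6 GEN 14's census file V26
`Spine/NE7b/CompactFibreWindowSU2Rate` (the window-volume letter of the `SU(2)` model at the true order `η^{3∕2}`, BOTH sides, and the
creation-step price with that letter) and V27 `Spine/NE7b/CompactFibreProfileVolumeSU2` (the PROFILE ∕ integrated-denominator letter — print's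
(1.2)∕(1.10) shape — with an inner window of radius² `σ`) consumed BY NAME at road (δ)'s live letters; imports those two files and this seat's
file 24 `LiveFactorWindowVolume` (for the one line `log_inv_mul_le`).  Nothing of Bałaban's is named; no `def`; 0 `sorry`.  Companion: file 28
`LiveFactorCreationLedger` (V28's power-counting ledger and V24's printed floor at live letters).

THE QUESTION (seat census `HOME/ne/NE7c.md` §20, row 47 = row 44 AT PRINT'S RATE).  Road (δ) (threshold randomisation, `Lit.T4ShellMeasure`
§6–§8) lowers every live small-field window by a factor chosen ONCE for the grid of assignments: the trace window `W_η = {2 − Re tr V ≤ η}`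
becomes `W_{νη}`, `ν ∈ [ν₀, 1]`, the large-field radius `δ′` becomes `s·δ′`, `s ∈ [λ₀, 1]`.  File 24 read ne6's rate-`2` letter
(`−log κ(W_η) ≤ #bonds·(2 log η⁻¹ + log 16)`): LOSS `2 log ν₀⁻¹` per bond.  V26 now supplies the letter at print's rate —
[Balaban1989LargeFieldII] p. 358 (1.10) «`E_k(Λ) = (−½d(𝔤)log g_k⁻² + log σ₀)|Λ^{(k)}∖G₀|`», `d(𝔤) = 3` for `SU(2)` — on BOTH sides
(`η√η∕160 ≤ Haar(W_η) ≤ 12η√η`).  Which part of (1.10)'s letter sees the assignment — the RATE `½d(𝔤)·log g_k⁻²` (the part that grows along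
the flow) or the CONSTANT `log σ₀`?

WHAT IS PROVED ([folklore]; ne6's theorems BY NAME at `η := νη`, `δ′ := sδ′`, plus real arithmetic):
* §0 `rate_mul_log_inv_mul_le` (`r·log (νη)⁻¹ ≤ r·log η⁻¹ + r·log ν₀⁻¹`, `r ≥ 0`, `ν ≥ ν₀ > 0`), `log_inv_le_log_inv_mul` (`log η⁻¹ ≤
  log (νη)⁻¹`, `0 < ν ≤ 1`: the other side only GAINS), `rate_live_loss_le` (`(3∕2)log ν₀⁻¹ ≤ 2 log ν₀⁻¹`: below file 24's loss),
  `letter_live_of_rate` (abstract: ANY letter `≤ n·(r·log η⁻¹ + c)` on `(0, η₀]` reads `≤ n·(r·log η⁻¹ + c) + n·r·log ν₀⁻¹` at a live window —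
  ready for the `SU(N)` letters at rate `½(N² − 1)`).
* §1 ONE BOND ∕ A REGION AT A LIVE WINDOW, BOTH SIDES: `neg_log_haar_traceWindow_le_sharp_live` (`−log Haar(W_{νη}) ≤ (3∕2)log η⁻¹ + log 160 +
  (3∕2)log ν₀⁻¹` — the LOWER-bound use of the window: LOSS `(3∕2)log ν₀⁻¹`, assignment-free), `le_neg_log_haar_traceWindow_live`
  (`(3∕2)log η⁻¹ − log 12 ≤ −log Haar(W_{νη})` — the UPPER-bound use: FREE), the region forms `neg_log_pi_traceWindow_le_sharp_live` ∕
  `le_neg_log_pi_traceWindow_live`, and the LIVE PIN **`abs_neg_log_pi_traceWindow_sub_le_live`**: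
  `|−log κ(W_{νη}) − #bonds·(3∕2)·log η⁻¹| ≤ #bonds·(log 160 + (3∕2)log ν₀⁻¹)` for EVERY `ν ∈ [ν₀, 1]` — the answer: the RATE is
  assignment-free, the live factor is absorbed in the O(1)-per-bond constant.
* §2 PRINT'S SHAPE AT A LIVE RADIUS: `volumeLetter_print_shape_live` — at window radius `√η = C·g` lowered to `√(νη) = (√ν·C)·g`,
  `(3∕2)log (ν(Cg)²)⁻¹ = (3∕2)log g⁻² − 3 log C + (3∕2)log ν⁻¹`: the live factor multiplies print's `C`, i.e. shifts `log σ₀`, never the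
  rate; **`neg_log_haar_traceWindow_le_print_shape_live`**: `−log Haar(W_{ν(Cg)²}) ≤ (3∕2)log g⁻² + (log 160 − 3 log C) + (3∕2)log ν₀⁻¹`.
* §3 THE CREATION-STEP PRICE WITH THE SHARP LETTER AT LIVE LETTERS (`SU(2)` model): `exponent_sharp_live_le`, **`creationPrice_SU2_sharp_live`**
  (V26's `creationPrice_SU2_sharp` at `(νη, sδ′)`, conclusion's constant `exp(i₀ − λ₀²·(λ∕2)δ′² + #bonds·((3∕2)log η⁻¹ + log 160) +
  #bonds·(3∕2)log ν₀⁻¹)` — ONE price for the grid), **`creationPrice_sharp_factor_le_exp_neg_live`** (the live ledger at rate `3∕2`: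
  `P + i₀ + #bonds·((3∕2)log η⁻¹ + log 160) + #bonds·(3∕2)log ν₀⁻¹ ≤ λ₀²·(λ∕2)δ′²`; by value in print's power-counting regime: file 28).
* §4 THE PROFILE LETTER AT A LIVE OUTER WINDOW (V27 BY NAME): **`neg_log_profileVolume_le_live`** — the profile's inner window `Π W_σ` (the
  Gaussian width) is NOT a small-field threshold and is not lowered; the outer window is: below the ONE nesting clause `σ ≤ ν₀·η`,
  `−log ∫_{Π W_{νη}} e^{−q} dκ ≤ q₀ + b(σ)` with the SAME `q₀`, `b` for every `ν` — FREE; **`neg_log_quadProfileVolume_le_sharp_live`**: V27 §6's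
  promised rate-`3∕2` form by value, `≤ #bonds·((3∕2)log σ⁻¹ + log 160 + ½)`, delivered at a live window and not mentioning `ν`.
* §5 sanity: at `ν₀ = ν = 1` the live pin is V26's pin.

CENSUS (row 47, NEW; `HOME/ne/NE7c.md` §20): the RATE `½d(𝔤)` of the window-volume letter — the part of (1.10) that grows along the flow —
is ASSIGNMENT-FREE under every member of road (δ) (single-level letter; (δ-1) and (δ-global…) alike); the live factor moves print's constant
`log σ₀` by at most `½d(𝔤)·log ν₀⁻¹` per degree of freedom (class C8 analogue; row 44 SHARPENED: `(3∕2)log ν₀⁻¹ ≤ 2 log ν₀⁻¹`), bounded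
and `k`-uniform — in print (1.10) is a vacuum-energy counterterm, so the located effect is a bounded shift of a normalisation constant — MILD in
the window-VOLUME currency (rows 44 ∕ 47 (i)); and in print's own INTEGRATED currency (V27's profile letter, (1.2) ⟹ (1.10)) the live factor on the
outer window is INVISIBLE below the nesting clause `σ ≤ ν₀η` («Gaussian width ≤ lowered window radius²» — in (1.2) p. 357 the `B′`-Gaussian has
width `O(1)` and the window is `|B′| < M₀g_k⁻¹ε_k = M₀A₀p₀(g_k)` with `ε_k = g_kA₀p₀(g_k)`, so the ratio is a power of `log g_k⁻²` and the clause has room to spare): rate AND constant assignment-free — FREE (row 47 (ii)).  The only live effect left at the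
creation step is the radius LOSS × `λ₀²` of census row 1.  BY-NAME EFFECT ON THE WALL: none (junction ∕ census file).

NOT HERE (honest): V27 §4's prices (`creationPrice_SU2_profile_valued` ∕ `…quadProfile_valued`) at live letters — one application as §3 with
`q₀ + b` unchanged (radius × `λ₀²` only); which `η(g_k)`, `σ(g_k)`, `C`, `σ₀` Bałaban's step carries and that its creation-step carrier IS the (n)-carrier — ne6's (A3) ∕ (A1c)
list applies verbatim (NC-NE7b-α UNRULED); node O; NE7c.  VERDICT WORD UNCHANGED: WORK-bound behind node O; INSTANCE 0∕1.  NE7c ∕ NE7b NOT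
PRINTED ∕ NOT PROVED; spine 0∕9; one finite T⁴ — NOT ℝ⁴, NOT infinite volume, NOT the mass gap, NOT Clay.
HONEST DEPENDENCY (cell): continuum YM on T⁴ ⇐ BetaPertH ∧ nine spine estimates (0∕9 proved); BetaPertH ⇐ (D1) ∧ (D4) ∧ CAP+tail.
-/

set_option autoImplicit false

noncomputable section

open MeasureTheory Real Finset Filter
open Literature.MathematicalPhysics.QuantumFieldTheory (haarProbability)
open Literature.MathematicalPhysics.QuantumLattice (su2Quat)
open Summit.QuantumFields.BalabanUV.T4Continuum.NE7b.CompactFibreWindowSU2Rate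
open Summit.QuantumFields.BalabanUV.T4Continuum.NE7b.CompactFibreProfileVolumeSU2 (pi_traceWindow_mono neg_log_profileVolume_le
  neg_log_quadProfileVolume_le)
open Summit.QuantumFields.BalabanUV.T4Continuum.Spine.NE7c.LiveFactorWindowVolume (log_inv_mul_le)

namespace Summit.QuantumFields.BalabanUV.T4Continuum.Spine.NE7c.LiveFactorWindowRate

/-! ## §0 Two lines of real arithmetic: a rate-`r` letter at a live window -/

/-- **THE RATE-`r` LETTER AT A LIVE WINDOW LOSES `r·log ν₀⁻¹`**: `r·log (νη)⁻¹ ≤ r·log η⁻¹ + r·log ν₀⁻¹` for `r ≥ 0`, `0 < ν₀ ≤ ν`, `η > 0`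
(file 24's `log_inv_mul_le` times `r`). [folklore] -/
theorem rate_mul_log_inv_mul_le {r ν ν₀ η : ℝ} (hr : 0 ≤ r) (hν₀ : 0 < ν₀) (hν : ν₀ ≤ ν) (hη : 0 < η) :
    r * Real.log (ν * η)⁻¹ ≤ r * Real.log η⁻¹ + r * Real.log ν₀⁻¹ := by
  have h := mul_le_mul_of_nonneg_left (log_inv_mul_le hν₀ hν hη) hr
  calc r * Real.log (ν * η)⁻¹ ≤ r * (Real.log η⁻¹ + Real.log ν₀⁻¹) := h
    _ = r * Real.log η⁻¹ + r * Real.log ν₀⁻¹ := by ring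

/-- **THE OTHER SIDE ONLY GAINS**: `log η⁻¹ ≤ log (νη)⁻¹` for `0 < ν ≤ 1`, `η > 0` (a lowered window is smaller). [folklore] -/
theorem log_inv_le_log_inv_mul {ν η : ℝ} (hν : 0 < ν) (hν1 : ν ≤ 1) (hη : 0 < η) :
    Real.log η⁻¹ ≤ Real.log (ν * η)⁻¹ := by
  have hlogν : 0 ≤ Real.log ν⁻¹ := by
    rw [Real.log_inv]; linarith [Real.log_nonpos hν.le hν1]
  rw [mul_inv, Real.log_mul (inv_ne_zero hν.ne') (inv_ne_zero hη.ne')]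
  linarith

/-- **THE RATE-`3∕2` LIVE LOSS IS BELOW THE RATE-`2` LIVE LOSS** of file 24: `(3∕2)·log ν₀⁻¹ ≤ 2·log ν₀⁻¹` for `0 < ν₀ ≤ 1`. [folklore] -/
theorem rate_live_loss_le {ν₀ : ℝ} (hν₀ : 0 < ν₀) (hν₀1 : ν₀ ≤ 1) :
    3 / 2 * Real.log ν₀⁻¹ ≤ 2 * Real.log ν₀⁻¹ := by
  have hlog : 0 ≤ Real.log ν₀⁻¹ := by
    rw [Real.log_inv]; linarith [Real.log_nonpos hν₀.le hν₀1]
  linarith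

/-- **ANY RATE-`r` LETTER AT A LIVE WINDOW** (abstract form, ready for the `SU(N)` letters at rate `½(N² − 1)`): if a window functional `Λ`
satisfies `Λ η′ ≤ n·(r·log η′⁻¹ + c)` for every `0 < η′ ≤ η₀`, then at a live window `Λ (νη) ≤ n·(r·log η⁻¹ + c) + n·(r·log ν₀⁻¹)` for
`0 < η ≤ η₀`, `ν ∈ [ν₀, 1]`, `ν₀ > 0`, `r, n ≥ 0` — the rate is assignment-free, the constant absorbs `r·log ν₀⁻¹`. [folklore] -/
theorem letter_live_of_rate {Λ : ℝ → ℝ} {r c n η₀ η ν ν₀ : ℝ} (hr : 0 ≤ r) (hn : 0 ≤ n)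
    (hΛ : ∀ η', 0 < η' → η' ≤ η₀ → Λ η' ≤ n * (r * Real.log η'⁻¹ + c))
    (hη0 : 0 < η) (hη : η ≤ η₀) (hν₀ : 0 < ν₀) (hν : ν₀ ≤ ν) (hν1 : ν ≤ 1) :
    Λ (ν * η) ≤ n * (r * Real.log η⁻¹ + c) + n * (r * Real.log ν₀⁻¹) := by
  have hνpos : 0 < ν := hν₀.trans_le hν
  have h := hΛ (ν * η) (mul_pos hνpos hη0) ((mul_le_of_le_one_left hη0.le hν1).trans hη)
  have hrate := rate_mul_log_inv_mul_le hr hν₀ hν hη0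
  have hstep : r * Real.log (ν * η)⁻¹ + c ≤ (r * Real.log η⁻¹ + c) + r * Real.log ν₀⁻¹ := by linarith
  have := mul_le_mul_of_nonneg_left hstep hn
  linarith

/-! ## §1 One bond and a region at a live window `W_{νη}`: the rate is assignment-free, both sides -/

section OneBond

/-- **ONE BOND AT A LIVE WINDOW, THE LOWER-BOUND USE (V26's sharp letter)**: `−log Haar_{SU(2)}(W_{νη}) ≤ (3∕2)log η⁻¹ + log 160 +
(3∕2)log ν₀⁻¹` for `0 < η ≤ ¼` and any live factor `ν ∈ [ν₀, 1]`, `ν₀ > 0` — V26's `neg_log_haar_traceWindow_le_sharp` at `νη` plus §0: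
LOSS `(3∕2)log ν₀⁻¹`, the same for every assignment. [folklore] -/
theorem neg_log_haar_traceWindow_le_sharp_live {η ν ν₀ : ℝ} (hη0 : 0 < η) (hη : η ≤ 1 / 4) (hν₀ : 0 < ν₀) (hν : ν₀ ≤ ν)
    (hν1 : ν ≤ 1) :
    -Real.log ((haarProbability (Matrix.specialUnitaryGroup (Fin 2) ℂ))
        {U : Matrix.specialUnitaryGroup (Fin 2) ℂ | 2 - ((U : Matrix (Fin 2) (Fin 2) ℂ).trace).re ≤ ν * η}).toReal ≤
      3 / 2 * Real.log η⁻¹ + Real.log 160 + 3 / 2 * Real.log ν₀⁻¹ := by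
  have hνpos : 0 < ν := hν₀.trans_le hν
  have hνη0 : 0 < ν * η := mul_pos hνpos hη0
  have hνη : ν * η ≤ 1 / 4 := (mul_le_of_le_one_left hη0.le hν1).trans hη
  have h := neg_log_haar_traceWindow_le_sharp hνη0 hνη
  have hr := rate_mul_log_inv_mul_le (r := 3 / 2) (by norm_num) hν₀ hν hη0
  linarith

/-- **ONE BOND AT A LIVE WINDOW, THE UPPER-BOUND USE**: `(3∕2)log η⁻¹ − log 12 ≤ −log Haar_{SU(2)}(W_{νη})` for `0 < η ≤ ¼`, `0 < ν ≤ 1` —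
V26's `le_neg_log_haar_traceWindow` at `νη` plus §0: FREE (a lowered window only has less volume). [folklore] -/
theorem le_neg_log_haar_traceWindow_live {η ν : ℝ} (hη0 : 0 < η) (hη : η ≤ 1 / 4) (hν : 0 < ν) (hν1 : ν ≤ 1) :
    3 / 2 * Real.log η⁻¹ - Real.log 12 ≤ -Real.log ((haarProbability (Matrix.specialUnitaryGroup (Fin 2) ℂ))
        {U : Matrix.specialUnitaryGroup (Fin 2) ℂ | 2 - ((U : Matrix (Fin 2) (Fin 2) ℂ).trace).re ≤ ν * η}).toReal := by
  have hνη0 : 0 < ν * η := mul_pos hν hη0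
  have hνη : ν * η ≤ 1 / 4 := (mul_le_of_le_one_left hη0.le hν1).trans hη
  have h := le_neg_log_haar_traceWindow hνη0 hνη
  have hfree := mul_le_mul_of_nonneg_left (log_inv_le_log_inv_mul hν hν1 hη0) (by norm_num : (0 : ℝ) ≤ 3 / 2)
  linarith

end OneBond

section Region

variable {B : Type*} [Fintype B]

/-- **A REGION AT A LIVE WINDOW, THE LOWER-BOUND USE**: `−log κ(W_{νη}) ≤ #bonds·((3∕2)log η⁻¹ + log 160) + #bonds·(3∕2)log ν₀⁻¹` for the
product trace window under the product Haar measure on `bonds → SU(2)`, `0 < η ≤ ¼`, `ν ∈ [ν₀, 1]`, `ν₀ > 0` — V26's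
`neg_log_pi_traceWindow_le_sharp` at `νη`: LOSS additive `(3∕2)log ν₀⁻¹` per bond, ASSIGNMENT-FREE. [folklore] -/
theorem neg_log_pi_traceWindow_le_sharp_live {η ν ν₀ : ℝ} (hη0 : 0 < η) (hη : η ≤ 1 / 4) (hν₀ : 0 < ν₀) (hν : ν₀ ≤ ν)
    (hν1 : ν ≤ 1) :
    -Real.log ((Measure.pi fun _ : B => haarProbability (Matrix.specialUnitaryGroup (Fin 2) ℂ))
        (Set.univ.pi fun _ : B =>
          {U : Matrix.specialUnitaryGroup (Fin 2) ℂ | 2 - ((U : Matrix (Fin 2) (Fin 2) ℂ).trace).re ≤ ν * η})).toReal ≤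
      (Fintype.card B : ℝ) * (3 / 2 * Real.log η⁻¹ + Real.log 160) + (Fintype.card B : ℝ) * (3 / 2 * Real.log ν₀⁻¹) := by
  have hνpos : 0 < ν := hν₀.trans_le hν
  have hνη0 : 0 < ν * η := mul_pos hνpos hη0
  have hνη : ν * η ≤ 1 / 4 := (mul_le_of_le_one_left hη0.le hν1).trans hη
  have h := neg_log_pi_traceWindow_le_sharp (B := B) hνη0 hνη
  have hr := rate_mul_log_inv_mul_le (r := 3 / 2) (by norm_num) hν₀ hν hη0
  have hn : (0 : ℝ) ≤ Fintype.card B := Nat.cast_nonneg _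
  have hstep : 3 / 2 * Real.log (ν * η)⁻¹ + Real.log 160 ≤
      (3 / 2 * Real.log η⁻¹ + Real.log 160) + 3 / 2 * Real.log ν₀⁻¹ := by linarith
  have := mul_le_mul_of_nonneg_left hstep hn
  linarith

/-- **A REGION AT A LIVE WINDOW, THE UPPER-BOUND USE**: `#bonds·((3∕2)log η⁻¹ − log 12) ≤ −log κ(W_{νη})` (`0 < η ≤ ¼`, `0 < ν ≤ 1`) —
V26's `le_neg_log_pi_traceWindow` at `νη`: FREE. [folklore] -/
theorem le_neg_log_pi_traceWindow_live {η ν : ℝ} (hη0 : 0 < η) (hη : η ≤ 1 / 4) (hν : 0 < ν) (hν1 : ν ≤ 1) :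
    (Fintype.card B : ℝ) * (3 / 2 * Real.log η⁻¹ - Real.log 12) ≤
      -Real.log ((Measure.pi fun _ : B => haarProbability (Matrix.specialUnitaryGroup (Fin 2) ℂ))
        (Set.univ.pi fun _ : B =>
          {U : Matrix.specialUnitaryGroup (Fin 2) ℂ | 2 - ((U : Matrix (Fin 2) (Fin 2) ℂ).trace).re ≤ ν * η})).toReal := by
  have hνη0 : 0 < ν * η := mul_pos hν hη0
  have hνη : ν * η ≤ 1 / 4 := (mul_le_of_le_one_left hη0.le hν1).trans hη
  have h := le_neg_log_pi_traceWindow (B := B) hνη0 hνη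
  have hfree := mul_le_mul_of_nonneg_left (log_inv_le_log_inv_mul hν hν1 hη0) (by norm_num : (0 : ℝ) ≤ 3 / 2)
  have hn : (0 : ℝ) ≤ Fintype.card B := Nat.cast_nonneg _
  have hstep : 3 / 2 * Real.log η⁻¹ - Real.log 12 ≤ 3 / 2 * Real.log (ν * η)⁻¹ - Real.log 12 := by linarith
  have := mul_le_mul_of_nonneg_left hstep hn
  linarith

/-- **THE LIVE PIN — THE RATE IS ASSIGNMENT-FREE**: `|−log κ(W_{νη}) − #bonds·(3∕2)·log η⁻¹| ≤ #bonds·(log 160 + (3∕2)log ν₀⁻¹)` for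
`0 < η ≤ ¼` and EVERY `ν ∈ [ν₀, 1]`, `ν₀ > 0`: the window-volume letter of the `SU(2)` model at a live window IS `(3∕2)·log η⁻¹ =
½d(𝔤)·log(radius⁻²)` per bond up to a bounded constant per bond in which the live factor sits — print's «`−½d(𝔤)log g_k⁻² + log σ₀`»
([Balaban1989LargeFieldII] (1.10)) with the RATE untouched and `σ₀` moved. [folklore] -/
theorem abs_neg_log_pi_traceWindow_sub_le_live {η ν ν₀ : ℝ} (hη0 : 0 < η) (hη : η ≤ 1 / 4) (hν₀ : 0 < ν₀) (hν : ν₀ ≤ ν)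
    (hν1 : ν ≤ 1) :
    |-Real.log ((Measure.pi fun _ : B => haarProbability (Matrix.specialUnitaryGroup (Fin 2) ℂ))
        (Set.univ.pi fun _ : B =>
          {U : Matrix.specialUnitaryGroup (Fin 2) ℂ | 2 - ((U : Matrix (Fin 2) (Fin 2) ℂ).trace).re ≤ ν * η})).toReal -
        (Fintype.card B : ℝ) * (3 / 2 * Real.log η⁻¹)| ≤
      (Fintype.card B : ℝ) * (Real.log 160 + 3 / 2 * Real.log ν₀⁻¹) := by
  have hup := neg_log_pi_traceWindow_le_sharp_live (B := B) hη0 hη hν₀ hν hν1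
  have hlow := le_neg_log_pi_traceWindow_live (B := B) hη0 hη (hν₀.trans_le hν) hν1
  have hn : (0 : ℝ) ≤ Fintype.card B := Nat.cast_nonneg _
  have h12 : Real.log 12 ≤ Real.log 160 + 3 / 2 * Real.log ν₀⁻¹ := by
    have h1 : Real.log 12 ≤ Real.log 160 := Real.log_le_log (by norm_num) (by norm_num)
    have h2 : 0 ≤ Real.log ν₀⁻¹ := by
      rw [Real.log_inv]; linarith [Real.log_nonpos hν₀.le (hν.trans hν1)]
    linarith
  have h12n := mul_le_mul_of_nonneg_left h12 hn
  rw [abs_le]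
  constructor <;> linarith

end Region

/-! ## §2 Print's shape at a live radius: the live factor multiplies `C`, i.e. moves `log σ₀`, never the rate `½d(𝔤)·log g⁻²` -/

/-- **PRINT'S SHAPE OF THE LETTER AT A LIVE RADIUS.**  At window radius `√η = C·g` lowered to `√(νη) = (√ν·C)·g` (`C, g, ν > 0`):
`(3∕2)·log (ν·(Cg)²)⁻¹ = (3∕2)·log g⁻² − 3·log C + (3∕2)·log ν⁻¹` — V26's `volumeLetter_print_shape` plus `log (ν·x)⁻¹ = log x⁻¹ + log ν⁻¹`:
the assignment enters print's constant (its `C`, i.e. `log σ₀`), the rate `½d(𝔤)·log g⁻²` is untouched. [folklore] -/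
theorem volumeLetter_print_shape_live {C g ν : ℝ} (hC : 0 < C) (hg : 0 < g) (hν : 0 < ν) :
    3 / 2 * Real.log (ν * (C * g) ^ 2)⁻¹ = 3 / 2 * Real.log (g ^ 2)⁻¹ - 3 * Real.log C + 3 / 2 * Real.log ν⁻¹ := by
  have hCg : (0 : ℝ) < (C * g) ^ 2 := by positivity
  rw [mul_inv, Real.log_mul (inv_ne_zero hν.ne') (inv_ne_zero hCg.ne'), mul_add, volumeLetter_print_shape hC hg]
  ring

/-- **HENCE, PER BOND AT A LIVE RADIUS**: with `(Cg)² ≤ ¼` and `ν ∈ [ν₀, 1]`, `ν₀ > 0`: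
`−log Haar(W_{ν(Cg)²}) ≤ (3∕2)·log g⁻² + (log 160 − 3·log C) + (3∕2)·log ν₀⁻¹` — rate `½d(𝔤) = 3∕2` in `log g⁻²` AS IN PRINT and for every
assignment; the constant `log 160 − 3 log C` (the model's `−log σ₀`) shifted by at most `(3∕2)·log ν₀⁻¹`. [folklore] -/
theorem neg_log_haar_traceWindow_le_print_shape_live {C g ν ν₀ : ℝ} (hC : 0 < C) (hg : 0 < g) (hη : (C * g) ^ 2 ≤ 1 / 4)
    (hν₀ : 0 < ν₀) (hν : ν₀ ≤ ν) (hν1 : ν ≤ 1) :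
    -Real.log ((haarProbability (Matrix.specialUnitaryGroup (Fin 2) ℂ))
        {U : Matrix.specialUnitaryGroup (Fin 2) ℂ | 2 - ((U : Matrix (Fin 2) (Fin 2) ℂ).trace).re ≤ ν * (C * g) ^ 2}).toReal ≤
      3 / 2 * Real.log (g ^ 2)⁻¹ + (Real.log 160 - 3 * Real.log C) + 3 / 2 * Real.log ν₀⁻¹ := by
  have h := neg_log_haar_traceWindow_le_sharp_live (by positivity : 0 < (C * g) ^ 2) hη hν₀ hν hν1
  rw [volumeLetter_print_shape hC hg] at h
  linarith

/-! ## §3 The (n)-carrier's creation-step price with the SHARP letter at live letters: ONE price for the grid -/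

/-- **THE LIVE EXPONENT ≤ THE ASSIGNMENT-FREE EXPONENT, RATE `3∕2`**: for `λ ≥ 0`, `0 ≤ λ₀ ≤ s`, `0 < ν₀ ≤ ν`, `η > 0`, `n ≥ 0`,
`i₀ − (λ∕2)(sδ′)² + n·((3∕2)log (νη)⁻¹ + log 160) ≤ i₀ − λ₀²·((λ∕2)δ′²) + n·((3∕2)log η⁻¹ + log 160) + n·(3∕2)log ν₀⁻¹`. [folklore] -/
theorem exponent_sharp_live_le {i₀ lam δ' s lam0 ν ν₀ η n : ℝ} (hlam : 0 ≤ lam) (h0 : 0 ≤ lam0) (hs : lam0 ≤ s)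
    (hν₀ : 0 < ν₀) (hν : ν₀ ≤ ν) (hη : 0 < η) (hn : 0 ≤ n) :
    i₀ - lam / 2 * (s * δ') ^ 2 + n * (3 / 2 * Real.log (ν * η)⁻¹ + Real.log 160) ≤
      i₀ - lam0 ^ 2 * (lam / 2 * δ' ^ 2) + n * (3 / 2 * Real.log η⁻¹ + Real.log 160) + n * (3 / 2 * Real.log ν₀⁻¹) := by
  have hsq : lam0 ^ 2 ≤ s ^ 2 := pow_le_pow_left₀ h0 hs 2
  have hfloor : lam0 ^ 2 * (lam / 2 * δ' ^ 2) ≤ lam / 2 * (s * δ') ^ 2 := by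
    have hnn : 0 ≤ lam / 2 * δ' ^ 2 := by positivity
    calc lam0 ^ 2 * (lam / 2 * δ' ^ 2) ≤ s ^ 2 * (lam / 2 * δ' ^ 2) := mul_le_mul_of_nonneg_right hsq hnn
      _ = lam / 2 * (s * δ') ^ 2 := by ring
  have hr := rate_mul_log_inv_mul_le (r := 3 / 2) (by norm_num) hν₀ hν hη
  have hstep : 3 / 2 * Real.log (ν * η)⁻¹ + Real.log 160 ≤
      (3 / 2 * Real.log η⁻¹ + Real.log 160) + 3 / 2 * Real.log ν₀⁻¹ := by linarith
  have hlog := mul_le_mul_of_nonneg_left hstep hn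
  linarith

section SU2

variable {B : Type*} [Fintype B] {Y : Type*} [MeasurableSpace Y] (μ : Measure Y) [SFinite μ]

/-- **THE (n)-CARRIER'S CREATION-STEP PRICE WITH THE SHARP LETTER AT LIVE LETTERS, ASSIGNMENT-FREE** (`SU(2)` model).  V26's
`creationPrice_SU2_sharp` with the large-field event at the LIVE radius `s·δ′` (`0 ≤ λ₀ ≤ s`), the denominator's window at the LIVE
half-width `νη` (`0 < η ≤ ¼`, `0 < ν₀ ≤ ν ≤ 1`; `hGwin ∕ hIrel` read on the live window), all other hypotheses verbatim; then
`∫ F·w·e^{−I} ≤ exp(i₀ − λ₀²·(λ∕2)δ′² + #bonds·((3∕2)log η⁻¹ + log 160) + #bonds·(3∕2)log ν₀⁻¹)·(∫F dκ)·∫ G·w·e^{−I}` — the SAME constant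
for every assignment `(s, ν)`: radius LOSS × `λ₀²` in the exponent (census row 1's pattern), volume LOSS additive `(3∕2)log ν₀⁻¹` per bond
(row 47, below row 44's `2 log ν₀⁻¹`), `i₀` FREE. [folklore] -/
theorem creationPrice_SU2_sharp_live {η ν ν₀ s lam0 : ℝ} (hη0 : 0 < η) (hη : η ≤ 1 / 4) (hν₀ : 0 < ν₀) (hν : ν₀ ≤ ν)
    (hν1 : ν ≤ 1) (h0 : 0 ≤ lam0) (hs : lam0 ≤ s)
    (F G : (B → Matrix.specialUnitaryGroup (Fin 2) ℂ) → ℝ) (w : Y → ℝ)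
    (I : (B → Matrix.specialUnitaryGroup (Fin 2) ℂ) × Y → ℝ) (m₀ : Y → ℝ) (U₀ : Y → (B → Matrix.specialUnitaryGroup (Fin 2) ℂ))
    {i₀ lam δ' : ℝ} (hF0 : ∀ x, 0 ≤ F x) (hG0 : ∀ x, 0 ≤ G x) (hw0 : ∀ y, 0 ≤ w y) (hlam : 0 ≤ lam) (hδ : 0 ≤ δ')
    (hF : ∀ x y, F x ≠ 0 → w y ≠ 0 → ∃ b : B, s * δ' ≤ ‖su2Quat ((U₀ y b)⁻¹ * x b) - 1‖)
    (hconv : ∀ x y, F x ≠ 0 → w y ≠ 0 → m₀ y + lam / 2 * ∑ b, ‖su2Quat ((U₀ y b)⁻¹ * x b) - 1‖ ^ 2 ≤ I (x, y))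
    (hGwin : ∀ y v, w y ≠ 0 →
      v ∈ (Set.univ.pi fun _ : B =>
        {U : Matrix.specialUnitaryGroup (Fin 2) ℂ | 2 - ((U : Matrix (Fin 2) (Fin 2) ℂ).trace).re ≤ ν * η}) →
      1 ≤ G (U₀ y * v))
    (hIrel : ∀ y v, w y ≠ 0 →
      v ∈ (Set.univ.pi fun _ : B =>
        {U : Matrix.specialUnitaryGroup (Fin 2) ℂ | 2 - ((U : Matrix (Fin 2) (Fin 2) ℂ).trace).re ≤ ν * η}) →
      I (U₀ y * v, y) ≤ m₀ y + i₀)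
    (hFi : Integrable F (Measure.pi fun _ : B => haarProbability (Matrix.specialUnitaryGroup (Fin 2) ℂ)))
    (hGI : ∀ y, w y ≠ 0 →
      Integrable (fun x => G x * exp (-I (x, y))) (Measure.pi fun _ : B => haarProbability (Matrix.specialUnitaryGroup (Fin 2) ℂ)))
    (hA' : Integrable (fun z : (B → Matrix.specialUnitaryGroup (Fin 2) ℂ) × Y => F z.1 * w z.2 * exp (-I z))
      ((Measure.pi fun _ : B => haarProbability (Matrix.specialUnitaryGroup (Fin 2) ℂ)).prod μ))
    (hB' : Integrable (fun z : (B → Matrix.specialUnitaryGroup (Fin 2) ℂ) × Y => G z.1 * w z.2 * exp (-I z))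
      ((Measure.pi fun _ : B => haarProbability (Matrix.specialUnitaryGroup (Fin 2) ℂ)).prod μ)) :
    ∫ z, F z.1 * w z.2 * exp (-I z) ∂((Measure.pi fun _ : B => haarProbability (Matrix.specialUnitaryGroup (Fin 2) ℂ)).prod μ) ≤
      exp (i₀ - lam0 ^ 2 * (lam / 2 * δ' ^ 2) + (Fintype.card B : ℝ) * (3 / 2 * Real.log η⁻¹ + Real.log 160)
            + (Fintype.card B : ℝ) * (3 / 2 * Real.log ν₀⁻¹)) *
        (∫ x, F x ∂(Measure.pi fun _ : B => haarProbability (Matrix.specialUnitaryGroup (Fin 2) ℂ))) *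
        ∫ z, G z.1 * w z.2 * exp (-I z) ∂((Measure.pi fun _ : B => haarProbability (Matrix.specialUnitaryGroup (Fin 2) ℂ)).prod μ) := by
  have hνpos : 0 < ν := hν₀.trans_le hν
  have hνη0 : 0 < ν * η := mul_pos hνpos hη0
  have hνη : ν * η ≤ 1 / 4 := (mul_le_of_le_one_left hη0.le hν1).trans hη
  have hsδ : 0 ≤ s * δ' := mul_nonneg (h0.trans hs) hδ
  -- V26's sharp price at the live letters `(νη, sδ′)`
  have key := creationPrice_SU2_sharp μ hνη0 hνη F G w I m₀ U₀ hF0 hG0 hw0 hlam hsδ hF hconv hGwin hIrel hFi hGI hA' hB'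
  -- the two nonnegative factors
  have hFint : 0 ≤ ∫ x, F x ∂(Measure.pi fun _ : B => haarProbability (Matrix.specialUnitaryGroup (Fin 2) ℂ)) :=
    integral_nonneg hF0
  have hint : 0 ≤ ∫ z, G z.1 * w z.2 * exp (-I z)
      ∂((Measure.pi fun _ : B => haarProbability (Matrix.specialUnitaryGroup (Fin 2) ℂ)).prod μ) :=
    integral_nonneg fun z => mul_nonneg (mul_nonneg (hG0 _) (hw0 _)) (exp_pos _).le
  -- exponent comparison
  have hexp := Real.exp_le_exp.2
    (exponent_sharp_live_le (i₀ := i₀) (δ' := δ') hlam h0 hs hν₀ hν hη0 (Nat.cast_nonneg (Fintype.card B)))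
  refine key.trans ?_
  have := mul_le_mul_of_nonneg_right (mul_le_mul_of_nonneg_right hexp hFint) hint
  simpa [mul_assoc] using this

end SU2

/-- **THE LIVE LEDGER AT RATE `3∕2`** (`SU(2)` model): with `∫F dκ ≤ 1` the live factor of every assignment (`s ≥ λ₀ ≥ 0`, `ν ∈ [ν₀, 1]`,
`η > 0`, `λ ≥ 0`) is `≤ e^{−P}` as soon as the ASSIGNMENT-FREE ledger inequality
`P + i₀ + #bonds·((3∕2)log η⁻¹ + log 160) + #bonds·(3∕2)log ν₀⁻¹ ≤ λ₀²·(λ∕2)δ′²` holds — V26's `creationPrice_sharp_factor_le_exp_neg` with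
the volume letter shifted by `(3∕2)log ν₀⁻¹` per bond and the floor scaled by `λ₀²`. [folklore] -/
theorem creationPrice_sharp_factor_le_exp_neg_live {η ν ν₀ s lam0 i₀ lam δ' A P : ℝ} {n : ℕ} (hA1 : A ≤ 1)
    (hlam : 0 ≤ lam) (h0 : 0 ≤ lam0) (hs : lam0 ≤ s) (hν₀ : 0 < ν₀) (hν : ν₀ ≤ ν) (hη : 0 < η)
    (hledger : P + i₀ + (n : ℝ) * (3 / 2 * Real.log η⁻¹ + Real.log 160) + (n : ℝ) * (3 / 2 * Real.log ν₀⁻¹) ≤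
      lam0 ^ 2 * (lam / 2 * δ' ^ 2)) :
    exp (i₀ - lam / 2 * (s * δ') ^ 2 + (n : ℝ) * (3 / 2 * Real.log (ν * η)⁻¹ + Real.log 160)) * A ≤ exp (-P) := by
  have hle := exponent_sharp_live_le (i₀ := i₀) (δ' := δ') hlam h0 hs hν₀ hν hη (Nat.cast_nonneg n)
  calc exp (i₀ - lam / 2 * (s * δ') ^ 2 + (n : ℝ) * (3 / 2 * Real.log (ν * η)⁻¹ + Real.log 160)) * A
      ≤ exp (i₀ - lam / 2 * (s * δ') ^ 2 + (n : ℝ) * (3 / 2 * Real.log (ν * η)⁻¹ + Real.log 160)) * 1 :=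
        mul_le_mul_of_nonneg_left hA1 (exp_pos _).le
    _ ≤ exp (-P) := by rw [mul_one]; exact Real.exp_le_exp.2 (by linarith)

/-! ## §4 The PROFILE letter (V27 — print's INTEGRATED shape (1.2)∕(1.10)) at a live OUTER window: FREE below one nesting clause -/

section Profile

variable {B : Type*} [Fintype B]

/-- **THE PROFILE LETTER AT A LIVE OUTER WINDOW IS FREE** (V27's `neg_log_profileVolume_le` BY NAME).  The profile `q ≤ q₀` lives on the INNER
window `Π_b W_σ` (print: the Gaussian width, `σ = g_k²`), the integral runs over the OUTER window, which road (δ) lowers to `Π_b W_{νη}`,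
`ν ∈ [ν₀, 1]`.  Below the ONE nesting clause `σ ≤ ν₀·η` (the lowered window still contains the inner one; `ν ∈ [ν₀, 1]`) and with `e^{−q}` integrable on
the dead window `Π_b W_η`: `−log ∫_{Π W_{νη}} e^{−q} dκ ≤ q₀ + b` with the SAME `q₀` and the SAME inner-window letter `b ≥ −log κ(Π W_σ)` for EVERY
`ν` — rate AND constant assignment-free: NO loss at all in print's integrated currency. [folklore] -/
theorem neg_log_profileVolume_le_live {σ η q₀ b ν ν₀ : ℝ} (hσ0 : 0 < σ) (hσ : σ ≤ 1 / 4) (hη : 0 ≤ η) (hν : ν₀ ≤ ν)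
    (hν1 : ν ≤ 1) (hnest : σ ≤ ν₀ * η)
    (hvol : -Real.log ((Measure.pi fun _ : B => haarProbability (Matrix.specialUnitaryGroup (Fin 2) ℂ))
        (Set.univ.pi fun _ : B =>
          {U : Matrix.specialUnitaryGroup (Fin 2) ℂ | 2 - ((U : Matrix (Fin 2) (Fin 2) ℂ).trace).re ≤ σ})).toReal ≤ b)
    (q : (B → Matrix.specialUnitaryGroup (Fin 2) ℂ) → ℝ)
    (hq : ∀ v ∈ (Set.univ.pi fun _ : B =>
      {U : Matrix.specialUnitaryGroup (Fin 2) ℂ | 2 - ((U : Matrix (Fin 2) (Fin 2) ℂ).trace).re ≤ σ}), q v ≤ q₀)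
    (hint : IntegrableOn (fun v => exp (-q v))
      (Set.univ.pi fun _ : B => {U : Matrix.specialUnitaryGroup (Fin 2) ℂ | 2 - ((U : Matrix (Fin 2) (Fin 2) ℂ).trace).re ≤ η})
      (Measure.pi fun _ : B => haarProbability (Matrix.specialUnitaryGroup (Fin 2) ℂ))) :
    -Real.log (∫ v in (Set.univ.pi fun _ : B =>
          {U : Matrix.specialUnitaryGroup (Fin 2) ℂ | 2 - ((U : Matrix (Fin 2) (Fin 2) ℂ).trace).re ≤ ν * η}),
        exp (-q v) ∂(Measure.pi fun _ : B => haarProbability (Matrix.specialUnitaryGroup (Fin 2) ℂ))) ≤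
      q₀ + b := by
  have hσνη : σ ≤ ν * η := hnest.trans (mul_le_mul_of_nonneg_right hν hη)
  have hνηη : ν * η ≤ η := mul_le_of_le_one_left hη hν1
  exact neg_log_profileVolume_le hσ0 hσ hσνη hvol q hq (hint.mono_set (pi_traceWindow_mono hνηη))

/-- **THE QUADRATIC TRACE PROFILE AT A LIVE OUTER WINDOW, RATE `3∕2` BY VALUE** — V27 §6's promised rate-`3∕2` form («the same one-liner with
V26's `neg_log_pi_traceWindow_le_sharp`»), delivered AT A LIVE WINDOW: for `0 < σ ≤ ¼`, `η ≥ 0`, `σ ≤ ν₀·η`, `ν₀ ≤ ν`: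
`−log ∫_{Π W_{νη}} exp(−(2σ)⁻¹Σ_b(2 − Re tr v_b)) dκ ≤ #bonds·((3∕2)·log σ⁻¹ + log 160 + ½)` — the bound does not mention `ν`: print's
«`−½d(𝔤)log g_k⁻² + log σ₀`» per degree of freedom, rate AND constant, survives road (δ) VERBATIM in the integrated currency. [folklore] -/
theorem neg_log_quadProfileVolume_le_sharp_live {σ η ν ν₀ : ℝ} (hσ0 : 0 < σ) (hσ : σ ≤ 1 / 4) (hη : 0 ≤ η)
    (hν : ν₀ ≤ ν) (hnest : σ ≤ ν₀ * η) :
    -Real.log (∫ v in (Set.univ.pi fun _ : B =>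
          {U : Matrix.specialUnitaryGroup (Fin 2) ℂ | 2 - ((U : Matrix (Fin 2) (Fin 2) ℂ).trace).re ≤ ν * η}),
        exp (-((2 * σ)⁻¹ * ∑ b, (2 - (((v b : Matrix.specialUnitaryGroup (Fin 2) ℂ) : Matrix (Fin 2) (Fin 2) ℂ).trace).re)))
          ∂(Measure.pi fun _ : B => haarProbability (Matrix.specialUnitaryGroup (Fin 2) ℂ))) ≤
      (Fintype.card B : ℝ) * (3 / 2 * Real.log σ⁻¹ + Real.log 160 + 1 / 2) := by
  have hσνη : σ ≤ ν * η := hnest.trans (mul_le_mul_of_nonneg_right hν hη)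
  have h := neg_log_quadProfileVolume_le (B := B) (η := ν * η) hσ0 hσ hσνη (neg_log_pi_traceWindow_le_sharp hσ0 hσ)
  linarith

end Profile

/-! ## §5 Sanity -/

/-- At `ν₀ = ν = 1` the live pin is V26's pin (`log 1⁻¹ = 0` inside the constant). -/
example {B : Type*} [Fintype B] {η : ℝ} (hη0 : 0 < η) (hη : η ≤ 1 / 4) :
    |-Real.log ((Measure.pi fun _ : B => haarProbability (Matrix.specialUnitaryGroup (Fin 2) ℂ))
        (Set.univ.pi fun _ : B =>
          {U : Matrix.specialUnitaryGroup (Fin 2) ℂ | 2 - ((U : Matrix (Fin 2) (Fin 2) ℂ).trace).re ≤ 1 * η})).toReal -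
        (Fintype.card B : ℝ) * (3 / 2 * Real.log η⁻¹)| ≤
      (Fintype.card B : ℝ) * (Real.log 160 + 3 / 2 * Real.log (1 : ℝ)⁻¹) :=
  abs_neg_log_pi_traceWindow_sub_le_live hη0 hη one_pos le_rfl le_rfl

end Summit.QuantumFields.BalabanUV.T4Continuum.Spine.NE7c.LiveFactorWindowRate

end
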